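import Literature.Geometry.Symplectic.SteinDomainSublevel
import HarnessLib

/-!
# Regular sublevel sets of `J`-convex functions in a Stein domain are Stein domains

Topic `Literature/Geometry/Symplectic`; proofs file of the fact seat of
`Literature.Geometry.Symplectic.Gompf1998_thm13_twoHandles` (**E2**, `SteinTwoHandles.lean`).
`SteinDomainSublevel.lean` equips a high sublevel set `{φ ≤ c}` *of the structure function*
`φ` of a Stein domain `(W, J, φ)` with the restricted Stein structure.  This file records the
(identical) construction for an **arbitrary** smooth function `ψ : W → ℝ`: if `{ψ ≤ c}` lies in
the interior of `W`, `c` is a regular value on `{ψ ≥ c}`, the level `{ψ = c}` is nonempty and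
`ψ` is strictly `J`-convex on `{ψ ≤ c}`, then `({ψ ≤ c}, J|, ψ|)` is a Stein domain
(`SteinStructure.sublevelOf`, `isSteinDomain_sublevelOf`) — Cieliebak–Eliashberg's standing
description of Stein domains as regular sublevel sets of `J`-convex functions (2012, Def. 1.1
ff., §1; Ch. 2 for `ℂⁿ`: *"sublevel sets of exhausting `J`-convex functions"*).  With
`W = B⁴ ⊂ ℂ²` and its standard structure (`SteinBall.lean`) this makes every compact regular
strongly `J₀`-convex domain of the ball a Stein domain in the tree's sense.

Everything is **proved** (the atlas is the tree's `sublevelAtlas`, the almost complex structure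
`RegularDomain.domJ`, integrability `RegularDomain.nijenhuis_domJ_eq_zero`, convexity the
naturality of the Levi form `Literature.Geometry.Kaehler.mextDeriv_pullback_apply`); no named
fact is introduced.

## References

* K. Cieliebak, Ya. Eliashberg, *From Stein to Weinstein and Back*, AMS Colloquium Publ. 59
  (2012), Def. 1.1 ff., §1, Ch. 2. [CieliebakEliashberg2012]
* J. Milnor, *Morse theory*, Ann. of Math. Studies 51 (1963), Thm. 3.1. [Milnor1963]
-/

noncomputable section

open scoped Manifold ContDiff Topology
open Set Function Filter VectorField Bundle

namespace Literature.Geometry.Symplectic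

open Literature.Topology.FourManifolds

/-! ### Preliminaries on the sublevel set as a type -/

section Prelim

variable {W : Type*} {ψ : W → ℝ} {c : ℝ}

/-- **The restricted function** `ψ ∘ ι` on `{ψ ≤ c}`. [folklore] -/
def sublevelOfφ (ψ : W → ℝ) (c : ℝ) (p : ↥(ψ ⁻¹' Iic c)) : ℝ := ψ p.1

/-- `ψ ∘ ι ≤ c` on the sublevel set. [folklore] -/
theorem sublevelOfφ_le (p : ↥(ψ ⁻¹' Iic c)) : sublevelOfφ ψ c p ≤ c := p.2

/-- If the level `{ψ = c}` is nonempty, `max (ψ ∘ ι) = c` on `{ψ ≤ c}`. [folklore] -/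
theorem sSup_range_sublevelOfφ (hne : ∃ x, ψ x = c) : sSup (range (sublevelOfφ ψ c)) = c := by
  obtain ⟨x, hx⟩ := hne
  have h1 : IsGreatest (range (sublevelOfφ ψ c)) c :=
    ⟨⟨⟨x, hx.le⟩, hx⟩, by rintro _ ⟨p, rfl⟩; exact sublevelOfφ_le p⟩
  exact h1.csSup_eq

/-- The sublevel set `{ψ ≤ c}` of a continuous function on a compact space is compact. [folklore] -/
theorem compactSpace_sublevelOf [TopologicalSpace W] [CompactSpace W] (hψc : Continuous ψ) (c : ℝ) :
    CompactSpace ↥(ψ ⁻¹' Iic c) :=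
  isCompact_iff_compactSpace.1 ((isClosed_Iic.preimage hψc).isCompact)

end Prelim

namespace SteinStructure

variable {W : Type*} [TopologicalSpace W] [T2Space W] [ChartedSpace (EuclideanHalfSpace 4) W]
  [IsManifold (𝓡∂ 4) ∞ W] [CompactSpace W] (S : SteinStructure W) {ψ : W → ℝ}
  (hψ : ContMDiff (𝓡∂ 4) 𝓘(ℝ, ℝ) ∞ ψ) {c : ℝ}
  (hint : ∀ x, ψ x ≤ c → (𝓡∂ 4).IsInteriorPoint x)
  (hreg : ∀ x, c ≤ ψ x → mfderiv (𝓡∂ 4) 𝓘(ℝ, ℝ) ψ x ≠ 0)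

/-! ### The manifold structure of `{ψ ≤ c}` -/

omit [T2Space W] [CompactSpace W] in
/-- The half-slice atlas of the sublevel set `{ψ ≤ c}` of a smooth function lying in the
interior of `W`, `c` a regular value on `{ψ ≥ c}`: the tree's `sublevelAtlas`.
[cite: Milnor1963, Thm. 3.1] -/
def sublevelOfAtlas (hψ : ContMDiff (𝓡∂ 4) 𝓘(ℝ, ℝ) ∞ ψ) (c : ℝ)
    (hint : ∀ x, ψ x ≤ c → (𝓡∂ 4).IsInteriorPoint x)
    (hreg : ∀ x, c ≤ ψ x → mfderiv (𝓡∂ 4) 𝓘(ℝ, ℝ) ψ x ≠ 0) :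
    HalfSliceAtlas (𝓡∂ 4) (ψ ⁻¹' Iic c) :=
  sublevelAtlas (k := 3) hψ c hint (fun p hp => hreg p hp.ge)

/-- **The restricted almost complex structure** `J^c_p = (Dι_p)⁻¹ ∘ J_p ∘ Dι_p` of `{ψ ≤ c}`
(`RegularDomain.domJ`). [cite: CieliebakEliashberg2012, Def. 1.1 ff.] -/
def sublevelOfJ (p : ↥(ψ ⁻¹' Iic c)) : EuclideanSpace ℝ (Fin 4) →L[ℝ] EuclideanSpace ℝ (Fin 4) :=
  letI := (sublevelOfAtlas hψ c hint hreg).chartedSpace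
  RegularDomain.domJ (sublevelOfAtlas hψ c hint hreg) rfl S.J p

omit [T2Space W] [CompactSpace W] in
/-- `ψ ∘ ι` is smooth. [folklore] -/
theorem contMDiff_sublevelOfφ :
    letI := (sublevelOfAtlas hψ c hint hreg).chartedSpace
    ContMDiff (𝓡∂ 4) 𝓘(ℝ, ℝ) ∞ (sublevelOfφ ψ c) := by
  letI := (sublevelOfAtlas hψ c hint hreg).chartedSpace
  haveI := (sublevelOfAtlas hψ c hint hreg).isManifold
  exact hψ.comp (RegularDomain.contMDiff_val (sublevelOfAtlas hψ c hint hreg) rfl)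

omit [T2Space W] [CompactSpace W] in
/-- **The differential of `ψ ∘ ι`** is `dψ ∘ Dι`. [folklore] -/
theorem mfderiv_sublevelOfφ_apply (p : ↥(ψ ⁻¹' Iic c)) (v : EuclideanSpace ℝ (Fin 4)) :
    letI := (sublevelOfAtlas hψ c hint hreg).chartedSpace
    mfderiv (𝓡∂ 4) 𝓘(ℝ, ℝ) (sublevelOfφ ψ c) p v =
      mfderiv (𝓡∂ 4) 𝓘(ℝ, ℝ) ψ p.1 (RegularDomain.valDeriv (sublevelOfAtlas hψ c hint hreg) rfl p v) := by
  letI := (sublevelOfAtlas hψ c hint hreg).chartedSpace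
  haveI := (sublevelOfAtlas hψ c hint hreg).isManifold
  have hφ : MDifferentiableAt (𝓡∂ 4) 𝓘(ℝ, ℝ) ψ p.1 := (hψ p.1).mdifferentiableAt (by simp)
  have hι : MDifferentiableAt (𝓡∂ 4) (𝓡∂ 4) (Subtype.val : ↥(ψ ⁻¹' Iic c) → W) p :=
    (RegularDomain.contMDiff_val (sublevelOfAtlas hψ c hint hreg) rfl p).mdifferentiableAt (by simp)
  rw [show sublevelOfφ ψ c = ψ ∘ Subtype.val from rfl, mfderiv_comp p hφ hι,
    RegularDomain.valDeriv_apply]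
  rfl

omit [T2Space W] in
/-- **`d^ℂ(ψ ∘ ι)` for `J^c` is the pull-back `ι^* (d^ℂ ψ)`.** [folklore] -/
theorem dComplex_sublevelOf_eq_pullback :
    letI := (sublevelOfAtlas hψ c hint hreg).chartedSpace
    dComplex (S.sublevelOfJ hψ hint hreg) (sublevelOfφ ψ c) =
      Kaehler.MForm.pullback (I' := 𝓡∂ 4) (𝓡∂ 4) (Subtype.val : ↥(ψ ⁻¹' Iic c) → W)
        (dComplex S.J ψ) := by
  letI := (sublevelOfAtlas hψ c hint hreg).chartedSpace
  funext p
  ext v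
  rw [dComplex_apply, Kaehler.MForm.pullback_apply, dComplex_apply, mfderiv_sublevelOfφ_apply]
  show mfderiv (𝓡∂ 4) 𝓘(ℝ, ℝ) ψ p.1 (RegularDomain.valDeriv (sublevelOfAtlas hψ c hint hreg) rfl p
    (RegularDomain.domJ (sublevelOfAtlas hψ c hint hreg) rfl S.J p (v 0))) = _
  rw [RegularDomain.valDeriv_domJ, RegularDomain.valDeriv_apply]

/-- **The Levi form of `ψ ∘ ι` is that of `ψ` on `Dι`-images**:
`-dd^ℂ(ψ∘ι)_p (v, J^c v) = -dd^ℂψ_p (Dι v, J (Dι v))`. [cite: CieliebakEliashberg2012, Def. 1.1 ff.] -/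
theorem mextDeriv_dComplex_sublevelOf_apply (p : ↥(ψ ⁻¹' Iic c)) (v : EuclideanSpace ℝ (Fin 4)) :
    letI := (sublevelOfAtlas hψ c hint hreg).chartedSpace
    Kaehler.mextDeriv (dComplex (S.sublevelOfJ hψ hint hreg) (sublevelOfφ ψ c)) p
        ![v, S.sublevelOfJ hψ hint hreg p v] =
      Kaehler.mextDeriv (dComplex S.J ψ) p.1
        ![RegularDomain.valDeriv (sublevelOfAtlas hψ c hint hreg) rfl p v,
          S.J p.1 (RegularDomain.valDeriv (sublevelOfAtlas hψ c hint hreg) rfl p v)] := by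
  letI := (sublevelOfAtlas hψ c hint hreg).chartedSpace
  haveI := (sublevelOfAtlas hψ c hint hreg).isManifold
  have hf : ∀ᶠ z in 𝓝 p, ContMDiffAt (𝓡∂ 4) (𝓡∂ 4) ∞ (Subtype.val : ↥(ψ ⁻¹' Iic c) → W) z :=
    Eventually.of_forall fun z => RegularDomain.contMDiff_val (sublevelOfAtlas hψ c hint hreg) rfl z
  have hβ : Kaehler.MForm.SmoothAt (dComplex S.J ψ) (p : W) :=
    isSmoothForm_dComplex_of_preservesSmoothFields S.preservesSmoothFields hψ p.1
  rw [dComplex_sublevelOf_eq_pullback, Kaehler.mextDeriv_pullback_apply hf hβ, Kaehler.MForm.pullback_apply]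
  congr 1
  funext i
  fin_cases i
  · exact (RegularDomain.valDeriv_apply (sublevelOfAtlas hψ c hint hreg) rfl p v).symm
  · show mfderiv (𝓡∂ 4) (𝓡∂ 4) Subtype.val p (S.sublevelOfJ hψ hint hreg p v) = _
    rw [← RegularDomain.valDeriv_apply (sublevelOfAtlas hψ c hint hreg) rfl]
    exact RegularDomain.valDeriv_domJ (sublevelOfAtlas hψ c hint hreg) rfl S.J p v

/-! ### The Stein structure -/

/-- **The Stein structure of a regular sublevel set `{ψ ≤ c}` of a `J`-convex function in a
Stein domain** (`{ψ ≤ c} ⊂ int W`, `c` a regular value on `{ψ ≥ c}`, the level `{ψ = c}`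
nonempty, `ψ` strictly `J`-convex on `{ψ ≤ c}`): the restricted almost complex structure
`J^c = (Dι)⁻¹ J Dι` and the restricted function `ψ ∘ ι`; integrability is
`RegularDomain.nijenhuis_domJ_eq_zero`, convexity the naturality of the Levi form and the
injectivity of `Dι`, the boundary `{ψ = c}` the regular maximal level set.
[cite: CieliebakEliashberg2012, Def. 1.1 ff.] -/
def sublevelOf (hconv : ∀ x, ψ x ≤ c → ∀ v : EuclideanSpace ℝ (Fin 4), v ≠ 0 →
      0 < -(Kaehler.mextDeriv (dComplex S.J ψ) x ![v, S.J x v])) (hne : ∃ x, ψ x = c) :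
    letI := (sublevelOfAtlas hψ c hint hreg).chartedSpace
    haveI := (sublevelOfAtlas hψ c hint hreg).isManifold
    haveI := compactSpace_sublevelOf hψ.continuous c
    SteinStructure ↥(ψ ⁻¹' Iic c) := by
  letI := (sublevelOfAtlas hψ c hint hreg).chartedSpace
  haveI := (sublevelOfAtlas hψ c hint hreg).isManifold
  haveI := compactSpace_sublevelOf hψ.continuous c
  exact
  { J := S.sublevelOfJ hψ hint hreg
    φ := sublevelOfφ ψ c
    J_sq := fun p v => RegularDomain.domJ_sq (sublevelOfAtlas hψ c hint hreg) rfl S.J S.J_sq p v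
    J_smooth := fun X hX =>
      RegularDomain.isSmoothVectorField_domJ (sublevelOfAtlas hψ c hint hreg) rfl S.J S.preservesSmoothFields hX
    integrable := fun X Y hX hY p =>
      RegularDomain.nijenhuis_domJ_eq_zero (sublevelOfAtlas hψ c hint hreg) rfl S.J S.preservesSmoothFields
        S.J_sq S.integrable hX hY p
    φ_smooth := contMDiff_sublevelOfφ hψ hint hreg
    convex := fun p v hv => by
      rw [S.mextDeriv_dComplex_sublevelOf_apply hψ hint hreg p v]
      exact hconv p.1 p.2 _ fun h0 => hv ((RegularDomain.valDeriv (sublevelOfAtlas hψ c hint hreg) rfl p).injective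
        (by rw [h0, map_zero]))
    boundary_eq := fun p => by
      rw [sSup_range_sublevelOfφ hne]
      exact isBoundaryPoint_sublevel_iff (k := 3) hψ c _ _ p
    regular := fun p hp => by
      have hpc : ψ p.1 = c := (isBoundaryPoint_sublevel_iff (k := 3) hψ c _ _ p).1 hp
      intro h0
      apply hreg p.1 hpc.ge
      ext u
      have h1 := mfderiv_sublevelOfφ_apply hψ hint hreg p
        ((RegularDomain.valDeriv (sublevelOfAtlas hψ c hint hreg) rfl p).symm u)
      rw [h0, ContinuousLinearEquiv.apply_symm_apply] at h1
      exact h1.symm }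

/-- The `J` of the structure is `(Dι)⁻¹ ∘ J ∘ Dι` (definitional). [folklore] -/
theorem sublevelOf_J_apply (hconv : ∀ x, ψ x ≤ c → ∀ v : EuclideanSpace ℝ (Fin 4), v ≠ 0 →
      0 < -(Kaehler.mextDeriv (dComplex S.J ψ) x ![v, S.J x v])) (hne : ∃ x, ψ x = c)
    (p : ↥(ψ ⁻¹' Iic c)) (v : EuclideanSpace ℝ (Fin 4)) :
    letI := (sublevelOfAtlas hψ c hint hreg).chartedSpace
    haveI := (sublevelOfAtlas hψ c hint hreg).isManifold
    haveI := compactSpace_sublevelOf hψ.continuous c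
    (S.sublevelOf hψ hint hreg hconv hne).J p v =
      (RegularDomain.valDeriv (sublevelOfAtlas hψ c hint hreg) rfl p).symm
        (S.J p.1 (RegularDomain.valDeriv (sublevelOfAtlas hψ c hint hreg) rfl p v)) := rfl

/-- The `φ` of the structure is `ψ ∘ ι` (definitional). [folklore] -/
theorem sublevelOf_φ_apply (hconv : ∀ x, ψ x ≤ c → ∀ v : EuclideanSpace ℝ (Fin 4), v ≠ 0 →
      0 < -(Kaehler.mextDeriv (dComplex S.J ψ) x ![v, S.J x v])) (hne : ∃ x, ψ x = c)
    (p : ↥(ψ ⁻¹' Iic c)) :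
    letI := (sublevelOfAtlas hψ c hint hreg).chartedSpace
    haveI := (sublevelOfAtlas hψ c hint hreg).isManifold
    haveI := compactSpace_sublevelOf hψ.continuous c
    (S.sublevelOf hψ hint hreg hconv hne).φ p = ψ p.1 := rfl

/-- **Regular sublevel sets of `J`-convex functions in a Stein domain are Stein domains.**
[cite: CieliebakEliashberg2012, Def. 1.1 ff.] -/
theorem isSteinDomain_sublevelOf (hconv : ∀ x, ψ x ≤ c → ∀ v : EuclideanSpace ℝ (Fin 4), v ≠ 0 →
      0 < -(Kaehler.mextDeriv (dComplex S.J ψ) x ![v, S.J x v])) (hne : ∃ x, ψ x = c) :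
    letI := (sublevelOfAtlas hψ c hint hreg).chartedSpace
    haveI := (sublevelOfAtlas hψ c hint hreg).isManifold
    haveI := compactSpace_sublevelOf hψ.continuous c
    IsSteinDomain ↥(ψ ⁻¹' Iic c) := by
  letI := (sublevelOfAtlas hψ c hint hreg).chartedSpace
  haveI := (sublevelOfAtlas hψ c hint hreg).isManifold
  haveI := compactSpace_sublevelOf hψ.continuous c
  exact ⟨S.sublevelOf hψ hint hreg hconv hne⟩

end SteinStructure

end Literature.Geometry.Symplectic

end
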